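/-
Copyright (c) 2026 the pub-hodgecm-mathlib formalisation cell (harness21).  Prover seat hodgecm-mathlib-K2E1-p15 (g0), Track B ∕ K2-LIT «5Res (b) BL-2(χ,τ)», h413 =
`stmt-HodgeConjecture-24833`, line `K2_E1_TraceFormulaBeta`, route of record `HCCMUnconditional`; dealer K2E1-plan (g7) ruling (205) «(b) FIRST»: the CONCRETE payer of the letter
`hδL` of ★ p859780 `hL2_chi_cm_two` ∕ ★ p859812 `hunq_chi_cm_two` (the `(χ, τ)` uniqueness head of row 12b ∕ X1_χ).
-/
import Summits.HodgeConjecture.HodgeConjecture.Theorems.K2E1ChiHomogeneousL2U2             -- ★ p859780 (this seat): `exists_ae_norm_deltaShift_le_of_ae_eq_mul_cpow`, `exists_ae_norm_deltaShift_sum_smul_le`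
import Summits.HodgeConjecture.HodgeConjecture.Theorems.K2E1ChiFlatSectionHNHolomorphicU2   -- ★ p859772 (this seat): `zFun_flatSectionU`, `norm_zFun_le`
import Summits.HodgeConjecture.HodgeConjecture.Theorems.K2E1BLXSystemPackageFinDimU         -- ★ row 11b (K2E3-p12): `sum_proj_smulRight_apply` (coordinates `B := ι → ℂ`)
import HarnessLib

/-!
# K2·E1 — `K2E1ChiConstantTermColumnsShiftBoundU2`: THE LETTER `hδL` OF THE `(χ, τ)` UNIQUENESS HEAD PAID — `δ(L z b′)` IS ESSENTIALLY BOUNDED ON `Z_{a₀}` FOR THE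
# CONSTANT-TERM FAMILY `L z b′ = Σ_j b′_j • α₂ j z`, `α₂ j z =ᵐ zFun(f_{1−z}^{φ′_j})`, `φ′_j` BOUNDED, ON THE TUBE `1 < Re z`

Track B ∕ K2-LIT, crux h413 = `stmt-HodgeConjecture-24833`; cell `hodgecm-mathlib`, squad K2, ENGINE E1, campaign «5Res», road «BL-2(χ,τ) ∘ MS-2(χ,τ) ∘ ARCH-UNITARITY ∘ R8₂»
(SHEET rows 11–12).  THEOREMS ONLY (no `def`, no `instance`, no notation, no named-fact hypothesis, no `sorry`); lane `--kind proof --supports stmt-HodgeConjecture-24833 --as helper`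
(count-neutral).  Closes no socket.

WHAT ([BernsteinLapid2019, §4 Claim 2 (p. 9), Claim 5 (p. 10)]).  The `L²`-letter ★ `hL2_chi_cm_two` and the uniqueness head ★ `hunq_chi_cm_two` carry the letter
`hδL : ∀ z ∈ D_n, 1 < Re z → ∀ b′, ∃ M, ‖δ(L z b′)‖ ≤ M a.e. on Z_{a₀}` — the essential bound of the smoothing `δ = R(h)|_{Z_{a₀}}` of the second constant-term vector.  For the
`(χ, τ)` system `L z b′ = Σ_j b′_j • α₂ j z` with COLUMNS `α₂ j z =ᵐ zFun(f_{1−z}^{φ′_j}) = zFun φ′_j · HZ^{1−z}` (★ `zFun_flatSectionU`), `φ′_j` bounded `χʷ`-sections (rows 2–4 ∕ 11b,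
★ `chiSectionSpace`): each column is paid by ★ `exists_ae_norm_deltaShift_le_of_ae_eq_mul_cpow` (`ψ̃ = zFun φ′_j` bounded by ★ `norm_zFun_le`, `w = 1 − z`, `Re w = 1 − Re z ≤ 0` on the
tube), and the sum by ★ `exists_ae_norm_deltaShift_sum_smul_le`.  After this file the letters of ★ `hunq_chi_cm_two` are `{hT, hδι, hK1}` (P3-C ★ `deltaShift_comp_iota`, K2 ★
`hK1_cm_two_of`) plus the `ShiftBound` right-shift data of this head (★ convData).
* §1 (rank `N`) **`hδL_of_columns`** — abstract coordinates `ℓ j : B → ℂ`, a finite set `s` of columns `α j z =ᵐ ψ̃_j · HZ^{1−z}` with `ψ̃_j` bounded: the letter `hδL` for any `L` with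
  `L z b′ = Σ_{j ∈ s} ℓ j b′ • α j z` on the tube.
* §2 (rank `N`) **`hδL_of_columns_flatSectionU`** — columns `α j z =ᵐ zFun (flatSectionU (φ′ j) (1 − z))`, `‖φ′ j‖ ≤ M j`; **`hδL_sum_proj_smulRight`** — the coordinate edition `B := ι → ℂ`,
  `L z := Σ_j proj_j.smulRight (α j z)` (★ 11b `sum_proj_smulRight_apply`), i.e. the letter of ★ `hunq_chi_cm_two` BYTE-FOR-BYTE for X1_χ's coordinate currency.

HONEST LABEL: HC_CM is proved only modulo the 7 printed citations (2 remaining named inputs: hLiu418 = `stmt-HodgeConjecture-24832`, h413 = `stmt-HodgeConjecture-24833`) until rung 0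
closes; this file asserts no named fact and closes no socket.

## References
* [BernsteinLapid2019] J. Bernstein, E. Lapid, *On the meromorphic continuation of Eisenstein series*, J. AMS 37 (2024) (arXiv:1911.02342), §4 Claims 2, 5 (pp. 9–10).
* [MoeglinWaldspurger1995] C. Mœglin, J.-L. Waldspurger, *Spectral decomposition and Eisenstein series* (1995), I.2.13, II.1.5.
* [Folland1999] G. B. Folland, *Real Analysis*, 2nd ed. (1999), Thm. 2.37.
-/

set_option autoImplicit false
set_option linter.dupNamespace false  -- the mandated namespace repeats the summit's segment (`HodgeConjecture.HodgeConjecture`)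

noncomputable section

open MeasureTheory MeasureTheory.Measure Set NumberField IsDedekindDomain Filter Topology Metric
open scoped NNReal ENNReal
open Literature.MeasureTheory.Group Literature.NumberTheory.Automorphic Literature.NumberTheory.Automorphic.UnitaryGroup AdelicGroupData
open Summit.HodgeConjecture.HodgeConjecture.Cruxes.H413.K2E1BorelEisensteinU
open Summit.HodgeConjecture.HodgeConjecture.Cruxes.H413.K2E1BLBorelSpacesU2Defs
open Summit.HodgeConjecture.HodgeConjecture.Cruxes.H413.K2E1BLBorelOperatorsU2Defs
open Summit.HodgeConjecture.HodgeConjecture.Cruxes.H413.K2E1ChiHomogeneousL2U2 (exists_ae_norm_deltaShift_le_of_ae_eq_mul_cpow exists_ae_norm_deltaShift_sum_smul_le)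
open Summit.HodgeConjecture.HodgeConjecture.Cruxes.H413.K2E1ChiFlatSectionHNHolomorphicU2 (zFun_flatSectionU norm_zFun_le)
open Summit.HodgeConjecture.HodgeConjecture.Cruxes.H413.K2E1BLXSystemPackageFinDimU (sum_proj_smulRight_apply)

namespace Summit.HodgeConjecture.HodgeConjecture.Cruxes.H413.K2E1ChiConstantTermColumnsShiftBoundU2

section Generic

variable {F E : Type} [Field F] [NumberField F] [Field E] [NumberField E] [Algebra F E] {c : E ≃ₐ[F] E} {N : ℕ} [NeZero N]
  [MeasurableSpace (quasiSplit F E c N).Adelic] [BorelSpace (quasiSplit F E c N).Adelic]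
  {k : ℕ} {a a₀ : ℝ≥0} {μZ : Measure (borelQuotient F E c N)} [SFinite μZ]
  {νG : Measure (quasiSplit F E c N).Adelic} [SFinite νG] {h : (quasiSplit F E c N).Adelic → ℂ}

/-! ## §1 The letter `hδL` from bounded columns `α j z =ᵐ ψ̃_j · HZ^{1−z}` -/

/-- **`hδL` FROM COLUMNS** (rank `N`): right-shift data of the `ShiftBound` discharge (`hright hΩm hκ hc hΩ hsupp hh`, as in ★ `exists_ae_norm_deltaShift_le_of_ae_eq_mul_cpow`), a finite
set `s` of columns `α j : ℂ → 𝓗_k(Z_a)` with `α j z =ᵐ ψ̃_j · HZ^{1−z}` on `Z_a` for `z` in the ball with `1 < Re z`, `ψ̃_j` BOUNDED, and any `L` with `L z b′ = Σ_{j∈s} ℓ j b′ • α j z`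
there.  THEN `∀ z ∈ D_n, 1 < Re z → ∀ b′, ∃ M, ‖δ(L z b′)‖ ≤ M` a.e. on `Z_{a₀}` — the letter `hδL` of ★ `hL2_chi_cm_two` ∕ ★ `hunq_chi_cm_two`.
[cite: BernsteinLapid2019, §4 Claim 5 (p. 10)] [cite: Folland1999, Thm. 2.37] -/
theorem hδL_of_columns (hright : ∀ y, MeasurePreserving (rightShift F E c N y) μZ μZ)
    {Ω : Set (quasiSplit F E c N).Adelic} (hΩm : MeasurableSet Ω) {κ : ℝ≥0} (hκ : 0 < κ) (hc : κ * a ≤ a₀)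
    (hΩ : ∀ z : borelQuotient F E c N, ∀ y ∈ Ω, borelQuotHeight F E c N z ≤ κ * borelQuotHeight F E c N (rightShift F E c N y z))
    (hsupp : ∀ y, y ∉ Ω → h y = 0) (hh : Integrable h νG) (hs : ShiftBound F E c N k a a₀ νG μZ h) (ha : 0 < a)
    (n : ℕ) {ι : Type*} (s : Finset ι) {ψt : ι → borelQuotient F E c N → ℂ} {M : ι → ℝ} (hψt : ∀ j x, ‖ψt j x‖ ≤ M j)
    (α : ι → ℂ → HN F E c N k a μZ)
    (hα : ∀ j, ∀ z ∈ ball (0 : ℂ) (n + 2), 1 < z.re →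
      ((α j z : HN F E c N k a μZ) : borelQuotient F E c N → ℂ) =ᵐ[weightedTruncMeasure F E c N k a μZ] fun x => ψt j x * (((borelQuotHeight F E c N x : ℝ≥0) : ℝ) : ℂ) ^ (1 - z))
    {B : Type*} [NormedAddCommGroup B] [NormedSpace ℂ B] (ℓ : ι → B → ℂ) (L : ℂ → B →L[ℂ] HN F E c N k a μZ)
    (hL : ∀ z ∈ ball (0 : ℂ) (n + 2), 1 < z.re → ∀ b' : B, L z b' = ∑ j ∈ s, ℓ j b' • α j z) :
    ∀ z ∈ ball (0 : ℂ) (n + 2), 1 < z.re → ∀ b' : B, ∃ M' : ℝ, ∀ᵐ x ∂(weightedTruncMeasure F E c N k a₀ μZ),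
      ‖(deltaShift hs (L z b') : borelQuotient F E c N → ℂ) x‖ ≤ M' := by
  intro z hz hz1 b'
  rw [hL z hz hz1 b']
  refine exists_ae_norm_deltaShift_sum_smul_le s hs (fun j => α j z) (fun j => ?_) (fun j => ℓ j b')
  exact exists_ae_norm_deltaShift_le_of_ae_eq_mul_cpow hright hΩm hκ hc hΩ hsupp hh hs ha (hψt j) (hα j z hz hz1)
    (by rw [Complex.sub_re, Complex.one_re]; linarith)

/-! ## §2 Columns `α j z =ᵐ zFun (f_{1−z}^{φ′_j})` with bounded sections, and the coordinate edition -/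

/-- **`hδL` FOR THE `(χ, τ)` COLUMNS `α j z =ᵐ zFun(f_{1−z}^{φ′_j})`** with `‖φ′_j‖ ≤ M_j` (bounded `χʷ`-sections): ★ `zFun_flatSectionU` turns the column into `zFun φ′_j · HZ^{1−z}` with
`‖zFun φ′_j‖ ≤ M_j` (★ `norm_zFun_le`), and §1 applies. [cite: BernsteinLapid2019, §4 Claim 5 (p. 10)] [cite: MoeglinWaldspurger1995, II.1.5] -/
theorem hδL_of_columns_flatSectionU (hright : ∀ y, MeasurePreserving (rightShift F E c N y) μZ μZ)
    {Ω : Set (quasiSplit F E c N).Adelic} (hΩm : MeasurableSet Ω) {κ : ℝ≥0} (hκ : 0 < κ) (hc : κ * a ≤ a₀)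
    (hΩ : ∀ z : borelQuotient F E c N, ∀ y ∈ Ω, borelQuotHeight F E c N z ≤ κ * borelQuotHeight F E c N (rightShift F E c N y z))
    (hsupp : ∀ y, y ∉ Ω → h y = 0) (hh : Integrable h νG) (hs : ShiftBound F E c N k a a₀ νG μZ h) (ha : 0 < a)
    (n : ℕ) {ι : Type*} (s : Finset ι) {φ' : ι → (quasiSplit F E c N).Adelic → ℂ} {M : ι → ℝ} (hφ'M : ∀ j g, ‖φ' j g‖ ≤ M j)
    (α : ι → ℂ → HN F E c N k a μZ)
    (hα : ∀ j, ∀ z ∈ ball (0 : ℂ) (n + 2), 1 < z.re →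
      ((α j z : HN F E c N k a μZ) : borelQuotient F E c N → ℂ) =ᵐ[weightedTruncMeasure F E c N k a μZ] zFun F E c N (flatSectionU (φ' j) (1 - z)))
    {B : Type*} [NormedAddCommGroup B] [NormedSpace ℂ B] (ℓ : ι → B → ℂ) (L : ℂ → B →L[ℂ] HN F E c N k a μZ)
    (hL : ∀ z ∈ ball (0 : ℂ) (n + 2), 1 < z.re → ∀ b' : B, L z b' = ∑ j ∈ s, ℓ j b' • α j z) :
    ∀ z ∈ ball (0 : ℂ) (n + 2), 1 < z.re → ∀ b' : B, ∃ M' : ℝ, ∀ᵐ x ∂(weightedTruncMeasure F E c N k a₀ μZ),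
      ‖(deltaShift hs (L z b') : borelQuotient F E c N → ℂ) x‖ ≤ M' :=
  hδL_of_columns hright hΩm hκ hc hΩ hsupp hh hs ha n s (ψt := fun j => zFun F E c N (φ' j)) (fun j x => norm_zFun_le (hφ'M j) x) α
    (fun j z hz hz1 => by rw [← zFun_flatSectionU (φ' j) (1 - z)]; exact hα j z hz hz1) ℓ L hL

/-- **`hδL` IN X1_χ's COORDINATE CURRENCY** (`B := ι → ℂ`, `L z := Σ_j proj_j.smulRight (α j z)`, ★ 11b `sum_proj_smulRight_apply`): for columns `α j z =ᵐ zFun(f_{1−z}^{φ′_j})` with bounded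
`φ′_j` the letter `hδL` of ★ `hunq_chi_cm_two` ∕ ★ `hL2_chi_cm_two` holds BYTE-FOR-BYTE. [cite: BernsteinLapid2019, §4 Claims 2, 5 (pp. 9–10)] -/
theorem hδL_sum_proj_smulRight (hright : ∀ y, MeasurePreserving (rightShift F E c N y) μZ μZ)
    {Ω : Set (quasiSplit F E c N).Adelic} (hΩm : MeasurableSet Ω) {κ : ℝ≥0} (hκ : 0 < κ) (hc : κ * a ≤ a₀)
    (hΩ : ∀ z : borelQuotient F E c N, ∀ y ∈ Ω, borelQuotHeight F E c N z ≤ κ * borelQuotHeight F E c N (rightShift F E c N y z))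
    (hsupp : ∀ y, y ∉ Ω → h y = 0) (hh : Integrable h νG) (hs : ShiftBound F E c N k a a₀ νG μZ h) (ha : 0 < a)
    (n : ℕ) {ι : Type*} [Fintype ι] {φ' : ι → (quasiSplit F E c N).Adelic → ℂ} {M : ι → ℝ} (hφ'M : ∀ j g, ‖φ' j g‖ ≤ M j)
    (α : ι → ℂ → HN F E c N k a μZ)
    (hα : ∀ j, ∀ z ∈ ball (0 : ℂ) (n + 2), 1 < z.re →
      ((α j z : HN F E c N k a μZ) : borelQuotient F E c N → ℂ) =ᵐ[weightedTruncMeasure F E c N k a μZ] zFun F E c N (flatSectionU (φ' j) (1 - z))) :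
    ∀ z ∈ ball (0 : ℂ) (n + 2), 1 < z.re → ∀ b' : ι → ℂ, ∃ M' : ℝ, ∀ᵐ x ∂(weightedTruncMeasure F E c N k a₀ μZ),
      ‖(deltaShift hs ((∑ j, (ContinuousLinearMap.proj (R := ℂ) (φ := fun _ : ι => ℂ) j).smulRight (α j z)) b') : borelQuotient F E c N → ℂ) x‖ ≤ M' :=
  hδL_of_columns_flatSectionU hright hΩm hκ hc hΩ hsupp hh hs ha n Finset.univ hφ'M α hα (fun j b' => b' j)
    (fun z => ∑ j, (ContinuousLinearMap.proj (R := ℂ) (φ := fun _ : ι => ℂ) j).smulRight (α j z)) fun z _ _ b' => sum_proj_smulRight_apply α z b'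

end Generic

end Summit.HodgeConjecture.HodgeConjecture.Cruxes.H413.K2E1ChiConstantTermColumnsShiftBoundU2

end
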